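import Summits.Ventures.Crystal3D.StickySpheres.SmallContactTargets
import Summits.Ventures.Crystal3D.StickySpheres.EightVertexSearch
import Summits.Ventures.Crystal3D.StickySpheres.TetraCaps
import Summits.Ventures.Crystal3D.StickySpheres.EightRelabel
import HarnessLib

/-!
# `C(8) = 18` unconditionally: the graph stratum `GSH(4, 19, 8)` discharged in the kernel

Venture `Crystal3D` (cell `pub-crystal3d`, seat p2), continuation of `ContactSeven.lean` / `GraphStratum.lean`.

PROVED OUTRIGHT here: **no graph on eight vertices with exactly nineteen edges and minimum degree `≥ 4` is relaxed-
realisable in `ℝ³`** (`graphStratumHypothesis_four_nineteen_eight`), hence **`C(8) = 18`** (`maxContacts_three_eight_eq`)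
by the bridge `maxContacts_three_eight_of_graphStratum` (which uses the already unconditional `C(7) = 15`). The proof is
the cell's reduction `T(8)` carried out inside the kernel:
1. a `19`-edge graph with all degrees `≥ 4` has a vertex `w` of degree exactly `4` (degree sum `38 < 40`); relabel so that
   `w = 7` and its neighbours are `3, 4, 5, 6` (`exists_relabel`, `EightRelabel.lean`; relaxed realisability is invariant);
2. the kernel search `EightSearch.exists_pattern` (`EightVertexSearch.lean`, `decide +kernel` in seven chunks) finds
   among the edges a labelled `K₅`, `K_{3,3}`, `K_{2,6}`, five-ring `K₂ ∨ C₅`, or one of the five metric eight-vertex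
   patterns (three bi-capped octahedra with touching caps, the tri-capped tetrahedron with a fourth cap, the closed strip
   of five tetrahedra about a vertex);
3. each is refuted for unit-ball configurations with all centre distances `≥ 1`: `no_contact_clique_five` (`NoK5`),
   `card_common_contactNeighbors_three_le_two'` / `card_common_contactNeighbors_le_five'` (`ContactGraphFilters`),
   `no_five_ring'` (`FiveRing`/`ContactSeven`), `no_bicapped_octahedron_opp/vtx/edge` (`OctahedronCaps`),
   `no_triakis_cap` / `no_tetra_strip` (`TetraCaps`).
Consequences: `numContacts_le_eighteen` (every packing of eight balls has `≤ 18` contacts), `stratumHypothesisMinDeg_eight`,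
`contactNumber_le_eighteen` (radius-`1` vocabulary), and the rows above restated with one hypothesis fewer:
`C(9) = 21 ⇐ GSH(4,22,9)`, `C(10) = 25 ⇐ GSH(4,22,9) ∧ GSH(5,26,10)`, `Statement.SmallContactUpperBounds ⇐` the three graph
strata for `n = 9, 10, 11`.

HONEST FRAMING: a finite combinatorial search plus folklore solid geometry, all kernel-checked with the standard axioms
(no `native_decide`, no census input); the strata for `n ≥ 9` remain hypotheses; nothing about crystallization.
-/

noncomputable section

open Finset
open scoped BigOperators

namespace Summit.Ventures.Crystal3D

open EightSearch

/-! ### 1. The stratum `(8, 19)` -/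

/-- **`GSH(4, 19, 8)` holds outright**: no graph on `Fin 8` with exactly `19` edges and minimum degree `≥ 4` is
relaxed-realisable in `ℝ³`. [folklore] -/
theorem graphStratumHypothesis_four_nineteen_eight : GraphStratumHypothesis 4 19 8 := by
  intro G _ hcard hdeg hreal
  classical
  -- 1. a vertex of degree exactly 4
  obtain ⟨w, hw⟩ : ∃ w, G.degree w = 4 := by
    by_contra hno
    push Not at hno
    have h5 : ∀ v, 5 ≤ G.degree v := fun v => by
      have h1 := hdeg v
      have h2 := hno v
      omega
    have hsum := G.sum_degrees_eq_twice_card_edges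
    rw [hcard] at hsum
    have h40 : 40 ≤ ∑ v, G.degree v :=
      calc (40 : ℕ) = ∑ _v : Fin 8, 5 := by simp
        _ ≤ ∑ v, G.degree v := Finset.sum_le_sum fun v _ => h5 v
    omega
  -- 2. relabel: `g 7 = w`, neighbours of `w` at `3,4,5,6`
  obtain ⟨g, hg7, hgN⟩ := exists_relabel G w hw
  set G' : SimpleGraph (Fin 8) := G.comap g with hG'
  have hadj' : ∀ i j, G'.Adj i j ↔ G.Adj (g i) (g j) := fun i j => Iff.rfl
  have hcard' : G'.edgeFinset.card = 19 := by
    rw [(SimpleGraph.Iso.comap g G).card_edgeFinset_eq, hcard]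
  obtain ⟨x, hxe, hxs⟩ := RelaxedRealisable.of_le_comap (G := G) (H := G') g g.injective le_rfl hreal
  -- 3. the missing slots
  set NC : Finset (Fin 8 × Fin 8) := univ.filter fun p => p.1 < p.2 ∧ ¬ G'.Adj p.1 p.2 with hNC
  set M : Finset ℕ := NC.image fun p => pidx p.1 p.2 with hMdef
  have hLT : (univ.filter fun p : Fin 8 × Fin 8 => p.1 < p.2).card = 28 := by decide
  have hAC := card_filter_lt_adj G'
  rw [hcard'] at hAC
  have hunion : (univ.filter fun p : Fin 8 × Fin 8 => p.1 < p.2 ∧ G'.Adj p.1 p.2) ∪ NC =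
      univ.filter fun p : Fin 8 × Fin 8 => p.1 < p.2 := by
    ext p
    simp only [mem_union, hNC, mem_filter, mem_univ, true_and]
    tauto
  have hdisj : Disjoint (univ.filter fun p : Fin 8 × Fin 8 => p.1 < p.2 ∧ G'.Adj p.1 p.2) NC := by
    rw [Finset.disjoint_left]
    intro p hp hq
    rw [mem_filter] at hp
    rw [hNC, mem_filter] at hq
    exact hq.2.2 hp.2.2
  have hNCcard : NC.card = 9 := by
    have h := card_union_of_disjoint hdisj
    rw [hunion, hLT, hAC] at h
    omega
  have hMcard : M.card = 9 := by
    rw [hMdef, card_image_of_injOn, hNCcard]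
    intro p hp q hq hpq
    rw [mem_coe, hNC, mem_filter] at hp hq
    have h := pidx_inj p.1 p.2 q.1 q.2 hp.2.1 hq.2.1 hpq
    exact Prod.ext h.1 h.2
  -- the slots at vertex `7`
  have h7adj : ∀ j : Fin 8, j ≠ 7 → (G'.Adj j 7 ↔ 3 ≤ j.val) := by
    intro j hj
    rw [hadj', hg7, G.adj_comm]
    exact hgN j hj
  have hM : ∀ i ∈ M, i < 21 ∨ i = 21 ∨ i = 22 ∨ i = 23 := by
    intro i hi
    obtain ⟨p, hp, rfl⟩ := mem_image.1 hi
    rw [hNC, mem_filter] at hp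
    obtain ⟨-, hlt, hna⟩ := hp
    have hne : p.1 ≠ p.2 := ne_of_lt hlt
    by_cases h2 : p.2 = 7
    · have h1 : p.1 ≠ 7 := fun h => hne (h.trans h2.symm)
      rw [h2] at hna
      have hlt3 : p.1.val < 3 := by
        by_contra h
        exact hna ((h7adj p.1 h1).2 (by omega))
      rw [h2, pidx_comm, pidx_seven p.1 h1]
      omega
    · have h1 : p.1 ≠ 7 := by
        intro h
        have := p.2.isLt
        have h' : p.1.val < p.2.val := hlt
        rw [h] at h'
        simp at h'
        omega
      exact Or.inl ((pidx_lt_twentyone p.1 p.2 hne).2 ⟨h1, h2⟩)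
  have hbase : ∀ a : Fin 8, a.val < 3 → pidx a 7 ∈ M := by
    intro a ha
    have ha7 : a ≠ 7 := by intro h; rw [h] at ha; simp at ha
    refine mem_image.2 ⟨(a, 7), ?_, rfl⟩
    rw [hNC, mem_filter]
    refine ⟨mem_univ _, Fin.lt_def.2 (by simp; omega), fun h => ?_⟩
    have := (h7adj a ha7).1 h
    omega
  have h21 : 21 ∈ M := by simpa [show pidx 0 7 = 21 by decide] using hbase 0 (by decide)
  have h22 : 22 ∈ M := by simpa [show pidx 1 7 = 22 by decide] using hbase 1 (by decide)
  have h23 : 23 ∈ M := by simpa [show pidx 2 7 = 23 by decide] using hbase 2 (by decide)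
  -- 4. contacts and distances of the relabelled configuration
  have hcon : ∀ a b : Fin 8, a ≠ b → pidx a b ∉ M → dist (x a) (x b) = 1 := by
    intro a b hab hS
    by_contra hd
    apply hS
    have hna : ¬ G'.Adj a b := fun h => hd (hxe a b h)
    rcases lt_or_gt_of_ne hab with hlt | hlt
    · exact mem_image.2 ⟨(a, b), by rw [hNC, mem_filter]; exact ⟨mem_univ _, hlt, hna⟩, rfl⟩
    · refine mem_image.2 ⟨(b, a), by rw [hNC, mem_filter]; exact ⟨mem_univ _, hlt, fun h => hna h.symm⟩, ?_⟩
      exact pidx_comm b a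
  have hy : IsUnitPacking x := fun i j hij => hxs i j hij
  -- 5. the search, and the nine refutations
  obtain ⟨p, hp, hfree⟩ := exists_pattern M hM h21 h22 h23 hMcard
  have hv := patList_valid p hp
  have hv1 : ∀ e ∈ p.edges, e.1 ≠ e.2 := fun e he => hv e (List.mem_append_left _ he)
  have hv2 : ∀ e ∈ p.non, e.1 ≠ e.2 := fun e he => hv e (List.mem_append_right _ he)
  have H1 : ∀ e ∈ p.edges, dist (x e.1) (x e.2) = 1 := fun e he => hcon _ _ (hv1 e he) (hfree e he)
  have H2 : ∀ e ∈ p.non, 1 ≤ dist (x e.1) (x e.2) := fun e he => hxs _ _ (hv2 e he)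
  clear hfree hv
  cases p with
  | k5 t =>
    obtain ⟨a, b, c, d, e⟩ := t
    simp only [Pat.edges, k5Edges, List.forall_mem_cons, List.not_mem_nil, false_implies, implies_true,
      and_true] at H1 hv1
    obtain ⟨hab, hac, had, hae, hbc, hbd, hbe, hcd, hce, hde⟩ := H1
    obtain ⟨nab, nac, nad, nae, nbc, nbd, nbe, ncd, nce, nde⟩ := hv1
    have hc5 : ({a, b, c, d, e} : Finset (Fin 8)).card = 5 := by
      rw [card_insert_of_notMem (by simp [nab, nac, nad, nae]), card_insert_of_notMem (by simp [nbc, nbd, nbe]),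
        card_insert_of_notMem (by simp [ncd, nce]), card_pair nde]
    refine no_contact_clique_five x {a, b, c, d, e} hc5 fun i hi j hj hij => ?_
    simp only [mem_insert, mem_singleton] at hi hj
    rcases hi with rfl | rfl | rfl | rfl | rfl <;> rcases hj with rfl | rfl | rfl | rfl | rfl <;>
      first
      | exact absurd rfl hij
      | assumption
      | (rw [dist_comm]; assumption)
  | k33 t =>
    obtain ⟨a, b, c, d, e, f⟩ := t
    simp only [Pat.edges, Pat.non, k33Edges, k33Non, List.forall_mem_cons, List.not_mem_nil, false_implies,
      implies_true, and_true] at H1 hv1 hv2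
    obtain ⟨had, hae, haf, hbd, hbe, hbf, hcd, hce, hcf⟩ := H1
    obtain ⟨nad, nae, naf, nbd, nbe, nbf, ncd, nce, ncf⟩ := hv1
    obtain ⟨nab, nac, nbc, nde, ndf, nef⟩ := hv2
    have hsub : ({d, e, f} : Finset (Fin 8)) ⊆ contactNeighbors x a ∩ contactNeighbors x b ∩ contactNeighbors x c := by
      intro j hj
      simp only [mem_insert, mem_singleton] at hj
      simp only [mem_inter, mem_contactNeighbors]
      rcases hj with rfl | rfl | rfl
      · exact ⟨⟨⟨nad.symm, had⟩, nbd.symm, hbd⟩, ncd.symm, hcd⟩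
      · exact ⟨⟨⟨nae.symm, hae⟩, nbe.symm, hbe⟩, nce.symm, hce⟩
      · exact ⟨⟨⟨naf.symm, haf⟩, nbf.symm, hbf⟩, ncf.symm, hcf⟩
    have h3 : ({d, e, f} : Finset (Fin 8)).card = 3 := by
      rw [card_insert_of_notMem (by simp [nde, ndf]), card_pair nef]
    have h2 := card_common_contactNeighbors_three_le_two' hy nab nac nbc
    have h3' := card_le_card hsub
    rw [h3] at h3'
    omega
  | k26 t =>
    obtain ⟨p, q, a, b, c, d, e, f⟩ := t
    simp only [Pat.edges, Pat.non, k26Edges, k26Non, List.forall_mem_cons, List.not_mem_nil, false_implies,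
      implies_true, and_true] at H1 hv1 hv2
    obtain ⟨hpa, hpb, hpc, hpd, hpe, hpf, hqa, hqb, hqc, hqd, hqe, hqf⟩ := H1
    obtain ⟨npa, npb, npc, npd, npe, npf, nqa, nqb, nqc, nqd, nqe, nqf⟩ := hv1
    obtain ⟨npq, nab, nac, nad, nae, naf, nbc, nbd, nbe, nbf, ncd, nce, ncf, nde, ndf, nef⟩ := hv2
    have hsub : ({a, b, c, d, e, f} : Finset (Fin 8)) ⊆ contactNeighbors x p ∩ contactNeighbors x q := by
      intro j hj
      simp only [mem_insert, mem_singleton] at hj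
      simp only [mem_inter, mem_contactNeighbors]
      rcases hj with rfl | rfl | rfl | rfl | rfl | rfl
      · exact ⟨⟨npa.symm, hpa⟩, nqa.symm, hqa⟩
      · exact ⟨⟨npb.symm, hpb⟩, nqb.symm, hqb⟩
      · exact ⟨⟨npc.symm, hpc⟩, nqc.symm, hqc⟩
      · exact ⟨⟨npd.symm, hpd⟩, nqd.symm, hqd⟩
      · exact ⟨⟨npe.symm, hpe⟩, nqe.symm, hqe⟩
      · exact ⟨⟨npf.symm, hpf⟩, nqf.symm, hqf⟩
    have h6 : ({a, b, c, d, e, f} : Finset (Fin 8)).card = 6 := by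
      rw [card_insert_of_notMem (by simp [nab, nac, nad, nae, naf]),
        card_insert_of_notMem (by simp [nbc, nbd, nbe, nbf]), card_insert_of_notMem (by simp [ncd, nce, ncf]),
        card_insert_of_notMem (by simp [nde, ndf]), card_pair nef]
    have h5 := card_common_contactNeighbors_le_five' hy npq
    have h6' := card_le_card hsub
    rw [h6] at h6'
    omega
  | ring t =>
    obtain ⟨p, q, a, b, c, d, e⟩ := t
    simp only [Pat.edges, Pat.non, ringEdges, ringNon, List.forall_mem_cons, List.not_mem_nil, false_implies,
      implies_true, and_true] at H1 H2
    obtain ⟨hpq, hpa, hpb, hpc, hpd, hpe, hqa, hqb, hqc, hqd, hqe, hab, hbc, hcd, hde, hea⟩ := H1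
    obtain ⟨hbd, had⟩ := H2
    exact no_five_ring' hpq hpa hpb hpc hpd hpe hqa hqb hqc hqd hqe hab hbc hcd hde hea hbd had
  | octOpp t =>
    obtain ⟨a, a', b, b', c, c', u, y⟩ := t
    simp only [Pat.edges, Pat.non, octOppEdges, octEdges, octNon, List.cons_append, List.nil_append,
      List.forall_mem_cons, List.not_mem_nil, false_implies, implies_true, and_true] at H1 H2
    obtain ⟨hab, hab', hac, hac', ha'b, ha'b', ha'c, ha'c', hbc, hbc', hb'c, hb'c', hxa, hxb, hxc, hya', hyb', hyc',
      hxy⟩ := H1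
    obtain ⟨haa', hbb', hcc', hxa', hya⟩ := H2
    exact no_bicapped_octahedron_opp hab hab' hac hac' ha'b ha'b' ha'c ha'c' hbc hbc' hb'c hb'c' haa' hbb' hcc' hxa hxb
      hxc hxa' hya' hyb' hyc' hya hxy
  | octVtx t =>
    obtain ⟨a, a', b, b', c, c', u, y⟩ := t
    simp only [Pat.edges, Pat.non, octVtxEdges, octEdges, octNon, List.cons_append, List.nil_append,
      List.forall_mem_cons, List.not_mem_nil, false_implies, implies_true, and_true] at H1 H2
    obtain ⟨hab, hab', hac, hac', ha'b, ha'b', ha'c, ha'c', hbc, hbc', hb'c, hb'c', hxa, hxb, hxc, hya', hyb', hyc,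
      hxy⟩ := H1
    obtain ⟨haa', hbb', hcc', hxa', hya⟩ := H2
    exact no_bicapped_octahedron_vtx hab hab' hac hac' ha'b ha'b' ha'c ha'c' hbc hbc' hb'c hb'c' haa' hbb' hcc' hxa hxb
      hxc hxa' hya' hyb' hyc hya hxy
  | octEdge t =>
    obtain ⟨a, a', b, b', c, c', u, y⟩ := t
    simp only [Pat.edges, Pat.non, octEdgeEdges, octEdges, octNon, List.cons_append, List.nil_append,
      List.forall_mem_cons, List.not_mem_nil, false_implies, implies_true, and_true] at H1 H2
    obtain ⟨hab, hab', hac, hac', ha'b, ha'b', ha'c, ha'c', hbc, hbc', hb'c, hb'c', hxa, hxb, hxc, hya', hyb, hyc,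
      hxy⟩ := H1
    obtain ⟨haa', hbb', hcc', hxa', hya⟩ := H2
    exact no_bicapped_octahedron_edge hab hab' hac hac' ha'b ha'b' ha'c ha'c' hbc hbc' hb'c hb'c' haa' hbb' hcc' hxa hxb
      hxc hxa' hya' hyb hyc hya hxy
  | triakis t =>
    obtain ⟨h, p, q, r, u, y, z, w'⟩ := t
    simp only [Pat.edges, Pat.non, triakisEdges, triakisNon, List.forall_mem_cons, List.not_mem_nil, false_implies,
      implies_true, and_true] at H1 H2
    obtain ⟨hhp, hhq, hhr, hpq, hpr, hqr, hxh, hxp, hxq, hyh, hyp, hyr, hzh, hzq, hzr, hwh, hwx, hwy, hwz⟩ := H1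
    obtain ⟨hxr, hyq, hzp⟩ := H2
    exact no_triakis_cap hhp hhq hhr hpq hpr hqr hxh hxp hxq hyh hyp hyr hzh hzq hzr hwh hwx hwy hwz hxr hyq hzp
  | strip t =>
    obtain ⟨h, v0, v1, v2, v3, v4, v5, v6⟩ := t
    simp only [Pat.edges, Pat.non, stripEdges, stripNon, List.forall_mem_cons, List.not_mem_nil, false_implies,
      implies_true, and_true] at H1 H2
    obtain ⟨h0, h1, h2, h3, h4, h5, h6, h01, h12, h23, h34, h45, h56, h02, h13, h24, h35, h46, h06⟩ := H1
    obtain ⟨h03, h14, h25, h36⟩ := H2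
    exact no_tetra_strip h0 h1 h2 h3 h4 h5 h6 h01 h12 h23 h34 h45 h56 h02 h13 h24 h35 h46 h06 h03 h14 h25 h36

/-- **`C(8) = 18`**, unconditionally. [folklore] -/
theorem maxContacts_three_eight_eq : maxContacts 3 8 = 18 :=
  maxContacts_three_eight_of_graphStratum graphStratumHypothesis_four_nineteen_eight

/-- **Eight balls have at most eighteen contacts** (no hypothesis on the packing). [folklore] -/
theorem numContacts_le_eighteen {x : Fin 8 → EuclideanSpace ℝ (Fin 3)} (hx : IsUnitPacking x) : numContacts x ≤ 18 :=
  numContacts_le_of_graphStratum (m := 7) (c' := 15) (c := 18) (d := 4) maxContacts_three_seven_eq.le (by norm_num)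
    graphStratumHypothesis_four_nineteen_eight hx

/-- **`S_d(18, 8)` for every minimum degree `d`** (in particular the census stratum `S_4(18, 8)`): discharged. [folklore] -/
theorem stratumHypothesisMinDeg_eight (d : ℕ) : StratumHypothesisMinDeg d 18 8 :=
  fun _ hx _ => numContacts_le_eighteen hx

open Literature.Geometry.DiscreteGeometry (IsUnitBallPacking) in
open Literature.Barriers.AtomisticToContinuum (contactNumber) in
/-- **`C(8) ≤ 18` in the radius-`1` vocabulary** (Bezdek's convention): for eight distinct points of `ℝ³` whose unit balls
do not overlap (pairwise distance `≥ 2`), at most eighteen pairs are at distance exactly `2`. Unconditional. [folklore] -/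
theorem contactNumber_le_eighteen (y : Fin 8 → EuclideanSpace ℝ (Fin 3)) (hy : Function.Injective y)
    (hP : IsUnitBallPacking (Set.range y)) : contactNumber y ≤ 18 := by
  rw [← numContacts_half_smul]
  exact numContacts_le_eighteen (isUnitPacking_half_smul hy hP)

/-! ### 2. The rows above, with one hypothesis fewer -/

/-- **`C(9) = 21`** from the single graph stratum `GSH(4, 22, 9)`. [folklore] -/
theorem maxContacts_three_nine_of_graphStratum (h9 : GraphStratumHypothesis 4 22 9) : maxContacts 3 9 = 21 :=
  maxContacts_three_nine_of_graphStrata graphStratumHypothesis_four_nineteen_eight h9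

/-- **`C(10) = 25`** from `GSH(4, 22, 9)` and `GSH(5, 26, 10)`. [folklore] -/
theorem maxContacts_three_ten_of_two_graphStrata (h9 : GraphStratumHypothesis 4 22 9)
    (h10 : GraphStratumHypothesis 5 26 10) : maxContacts 3 10 = 25 :=
  maxContacts_three_ten_of_graphStrata graphStratumHypothesis_four_nineteen_eight h9 h10

/-- **The venture's target `SmallContactUpperBounds`** (`C(9) ≤ 21 ∧ C(10) ≤ 25 ∧ C(11) ≤ 29`) from the THREE graph strata
`GSH(4,22,9)`, `GSH(5,26,10)`, `GSH(5,30,11)` (the `n = 8` stratum is no longer a hypothesis). [folklore] -/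
theorem smallContactUpperBounds_of_three_graphStrata (h9 : GraphStratumHypothesis 4 22 9)
    (h10 : GraphStratumHypothesis 5 26 10) (h11 : GraphStratumHypothesis 5 30 11) : SmallContactUpperBounds :=
  smallContactUpperBounds_of_graphStrata graphStratumHypothesis_four_nineteen_eight h9 h10 h11

/-- The printed values `C(9) = 21`, `C(10) = 25`, `C(11) = 29` from the three graph strata `n = 9, 10, 11`. [folklore] -/
theorem smallContact_eq_of_three_graphStrata (h9 : GraphStratumHypothesis 4 22 9) (h10 : GraphStratumHypothesis 5 26 10)
    (h11 : GraphStratumHypothesis 5 30 11) : maxContacts 3 9 = 21 ∧ maxContacts 3 10 = 25 ∧ maxContacts 3 11 = 29 :=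
  (smallContact_eq_of_graphStrata graphStratumHypothesis_four_nineteen_eight h9 h10 h11).2

/-- **The table from the graph strata for `n ≥ 9` only.** If `GSH(d_n, c_n + 1, n)` holds for `9 ≤ n ≤ 13`, then
`C(n) = contactTable n` (`6, 9, 12, 15, 18, 21, 25, 29, 33, 36`) for every `4 ≤ n ≤ 13`; rows `n ≤ 8` are unconditional.
[folklore] -/
theorem maxContacts_eq_contactTable_of_graphStrata_ge_nine
    (hG : ∀ n, 9 ≤ n → n ≤ 13 → GraphStratumHypothesis (minDegTable n) (contactTable n + 1) n)
    {n : ℕ} (h4 : 4 ≤ n) (h13 : n ≤ 13) : maxContacts 3 n = contactTable n := by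
  refine maxContacts_eq_contactTable_of_graphStrata (fun m h8 hm13 => ?_) h4 h13
  by_cases hm : m = 8
  · subst hm
    simpa [contactTable, minDegTable] using graphStratumHypothesis_four_nineteen_eight
  · exact hG m (by omega) hm13

/-- **Rows `n ≤ 8`: `C(n) = 3n − 6` for all `4 ≤ n ≤ 8`**, unconditionally. [folklore] -/
theorem maxContacts_eq_three_mul_sub_six_of_le_eight {n : ℕ} (h4 : 4 ≤ n) (h8 : n ≤ 8) :
    maxContacts 3 n = 3 * n - 6 := by
  interval_cases n
  · simpa using maxContacts_three_four
  · simpa using maxContacts_three_five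
  · simpa using maxContacts_three_six
  · simpa using maxContacts_three_seven_eq
  · simpa using maxContacts_three_eight_eq

end Summit.Ventures.Crystal3D

end
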